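import Summits.BirchSwinnertonDyer.BirchSwinnertonDyer.Theorems.SemiOrdinaryEisensteinDescentWildSplitEisensteinValueAtOneVIndexCurrency
import Summits.BirchSwinnertonDyer.BirchSwinnertonDyer.Theorems.SemiOrdinaryEisensteinDescentWildSplitEisensteinInclusionAtThreeCertificateRoad
import HarnessLib

/-!
# Route `SemiOrdinaryEisensteinDescent` (SOED), crux #2 of record `WildSplitEisensteinValueAtOneV`
# (stmt-BirchSwinnertonDyer-26610, `E_𝟙^V`), registered line `index`: the KOLYVAGIN-SIDE REDUCTION of the line's
# research stub `stub_indexLowerBoundFH` (`I_FH`) BY NAME — McCallum 1991 Cor. 5.6 (lower, certificate form, the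
# tree's named Literature fact) + ONE Kolyvagin point-certificate per Friedberg–Hoffstein datum on the tower-onto
# rows + the non-tower rows displayed — and the crux BY NAME from the same inputs
# (cell `pub/bsd-wall`, width seat `bsd-wall-soed-p1-w3` g15, `--supports stmt-BirchSwinnertonDyer-26610`, helper;
# no definition, no named fact minted, no `sorry`)

WHY. Line `index` (skeleton 92a01debefa51d83, staged by soed-p1-w2 g12, registered on 26610 by this seat) has ONE
research stub, in index currency and with no Iwasawa theory in it:

  `I_FH`: at every Heegner datum `(K, Dt, H, ι, P = y_K)` of the O6 / `ρ̄₃`-onto / `r_an = 1` cell with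
  `L(E^(d_K),1) ≠ 0`, `P` non-torsion and `d_K` odd, `SchneiderFree.IndexLowerBoundLeAt W 3 K P (v₃ c)`, i.e.
  `2·ord₃[E(K):ℤP] ≤ ord₃ #Ш(E/K) + 2·ord₃ ∏_ℓ c_ℓ(E) + 2·v₃(c(Dt))`,

and `E_𝟙^V` follows from it over print + Poitou–Tate (p614377 §2). The Eisenstein-congruence ENGINES for `I_FH` died ×4
(`Cruxes/WildSplitEisensteinInclusionAtThree/Lines/birth-dead*.md`, walls W1–W3). The OTHER road to `I_FH` — Kolyvagin's
structure theorem in McCallum's LOWER certificate form — was kernel-certified by this seat's lineage for the aside crux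
`E′` and for the leaf (`…WildSplitEisensteinInclusionAtThreeCertificateRoad.lower_of_certificate`, w3 g5), but never
re-targeted to the crux of record or to the registered stub's exact signature (free level `N` with `N_E = N`). This
file does that bookkeeping, so that a stub worker on `stub_indexLowerBoundFH` finds BOTH roads in the tree by name:

* §0 `indexLowerBoundLeAt_of_index_le_budget` — the IDLE ROWS: where `ord₃[E(K):ℤP] ≤ ord₃∏c_ℓ + s` the inequality
  holds with NO input (`ord₃ #Ш ≥ 0`); on the census's «jet-exact» rows (i3 = t3, 3 413 of the 3 894 classes at the
  `D` of record, utd-p3 g1/g4) `I_FH` asks nothing — its content lives on the INDEX-EXCESS rows only.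
* §1 `indexLowerBoundLeAt_FH_of_certificate` — POINTWISE at an `I_FH` datum (free `N`, `W.conductorNorm ℤ = N`):
  Kolyvagin (rank one, `Ш(E/K)` finite; a PUB conjunct) + McCallum Cor. 5.6 lower form
  (`McCallum1991_pow_dvd_card_sha_primary_of_certificate`, NAMED, hypothesis) + `3`-adic tower surjectivity of `W` +
  ONE certificate «a square-free `n` of Kolyvagin primes of index `≥ t+s+1` and a Kolyvagin–Heegner datum `d` of
  conductor `n` on the frame `(Dt, H.β, ι)` with `P_n ∉ 3^{t+s+1}E(K[n])`», `t = ord₃∏c_ℓ(E)`, `s = v₃(c(Dt))`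
  ⟹ `IndexLowerBoundLeAt W 3 K P s` (`d_K ≠ −3` because `3 ∣ N` splits in `K`; `d_K ≠ −4` because `d_K` is odd).
* §2 `indexLowerBoundFH_of_certificates` — `I_FH` VERBATIM (the registered signature of `stub_indexLowerBoundFH`) ⟸
  Kolyvagin ∧ McCallum (lower, named) ∧ `CERT₃^FH` (displayed: ONE certificate at every INDEX-EXCESS FH datum
  (`ord₃[E(K):ℤP] > ord₃∏c_ℓ + v₃(c)`) with odd `d_K` of every TOWER-onto cell curve) ∧ `I_FH|NT` (displayed: the
  inequality itself at the index-excess data of the onto-mod-3-not-mod-9 rows — Elkies' 39 census classes — where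
  McCallum's `3`-adic image hypothesis fails); the idle rows are served by §0.
* §3 `valueAtOneV_of_certificates_of_poitouTate` / `…_of_poitouTateConj` — THE CRUX OF RECORD BY NAME:
  `PublishedInputsWildThree → McCallum (lower) → CERT₃^FH → I_FH|NT → PT1 (resp. the conj input 23092) → PT2 →
  WildSplitEisensteinValueAtOneV` (§2 ∘ p614377 §2) — i.e. the line `index` with its research stub REPLACED by
  {one print fact, one per-pair-decidable certificate statement, the non-tower residue}.

READING (for the pen / the next lead; nothing is re-typed here). On the tower-onto rows the ONLY non-published input
left under `E_𝟙^V` is `CERT₃^FH` = «`M_∞ ≤ ord₃(c·∏c_ℓ)` at FH data» in McCallum's POINT currency — research-open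
class-wide (no BD-admissible primes at `3`, so W. Zhang 2014 / BCGS do not transfer), but DECIDABLE PAIR BY PAIR by a
finite computation of ONE derived Heegner point `P_ℓ` over `K[ℓ]` (Jetchev–Lauter–Stein 2009 §4): a certificate of
depth `≤ t+s` at a pair PROVES the lower half there (modulo the McCallum fact), the exact mirror of the route's
CHEAPEST FALSIFIER (which can only refute). A `certificate` variant of line `index` would read: stubs `PUB`, `PTc`,
`PT2`, McCallum-lower (print, named fact), `CERT₃^FH` (research, instrument-shaped), `I_FH|NT` (research, 39 known
classes; or the banked residual `WildRankOneSurjNonTowerAtThree` after restriction).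

HONEST FRAMING: theorems only; every crux, fact and certificate statement is a HYPOTHESIS; nothing is asserted about
any curve; closes nothing; `E_𝟙^V`, `I_FH`, `CERT₃^FH` stay OPEN; BSD₃ is proved for no curve. No definition, no named
fact, no `sorry`.

References: [McCallumLMS1991] §4 `S_r(M)` (pp. 299–300), §5 Lemma 5.1 (p. 303), Cor. 5.6 (p. 310); [Kolyvagin1990]
Thm. A; [WZhang2014] Thm. 1.1, §3.8, Remark 18; [Jetchev2008] Conj. 1.3, Thm. 1.4; [JetchevLauterStein2009]
Prop. 4.1–4.2 (arXiv:0707.0032); [JetchevSkinnerWan2017] §7.4.1 (eq:shalowerK-1) (arXiv:1512.06894 p. 30);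
[GrossZagier1986] I.(6.3), V.§2; [FriedbergHoffstein1995] Thm. B; [Elkies2006] (arXiv:math/0612734);
[MilneADT2006] I Thm. 4.10.
-/

noncomputable section

open scoped Classical NumberField

set_option linter.dupNamespace false -- `Summit.BirchSwinnertonDyer.BirchSwinnertonDyer.Theorems.…` (summit = sub, D-0017)
set_option autoImplicit false

namespace Summit.BirchSwinnertonDyer.BirchSwinnertonDyer.Theorems.WildSplitEisensteinValueAtOneVCertificateRoad

open WeierstrassCurve NumberField IsDedekindDomain Field
  Literature.NumberTheory.EllipticCurves
  Literature.NumberTheory.EllipticCurves.ModularForms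
  Literature.NumberTheory.EllipticCurves.Rank1Residual
  Literature.NumberTheory.GaloisCohomology
  Summit.BirchSwinnertonDyer.Rank1Residual
  Summit.BirchSwinnertonDyer.Rank1Residual.Additive
  Summit.BirchSwinnertonDyer.Rank1Residual.X11b
  Summit.BirchSwinnertonDyer.Rank1Residual.X11b.Three
  Summit.BirchSwinnertonDyer.BirchSwinnertonDyer.Theses.SemiOrdinaryEisensteinDescent
  Summit.BirchSwinnertonDyer.BirchSwinnertonDyer.Theorems

/-! ### §0 The idle rows: index within the Tamagawa–Manin budget -/

/-- **`I_FH` is free where the Heegner index is within budget.** If `ord_p[E(K):ℤP] ≤ ord_p ∏_ℓ c_ℓ(E) + s` then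
`SchneiderFree.IndexLowerBoundLeAt W p K P s` (`2·ord_p[E(K):ℤP] ≤ ord_p #Ш(E/K) + 2·ord_p∏c_ℓ + 2s`) holds with no
further input, since `ord_p #Ш(E/K) ≥ 0`. On the census's jet-exact rows (i3 = t3) the Eisenstein-side crux is idle.
[folklore] -/
theorem indexLowerBoundLeAt_of_index_le_budget (W : WeierstrassCurve ℚ) (p : ℕ) (K : Type) [Field K] [NumberField K]
    (P : (W.baseChange K).toAffine.Point) (s : ℕ)
    (h : padicValNat p (AddSubgroup.zmultiples P).index ≤ padicValNat p W.tamagawaProduct + s) :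
    SchneiderFree.IndexLowerBoundLeAt W p K P s := by
  unfold SchneiderFree.IndexLowerBoundLeAt
  omega

/-! ### §1 Pointwise: `I_FH` at ONE datum from McCallum (lower, named) and ONE certificate -/

/-- **`I_FH` at ONE Friedberg–Hoffstein datum of the cell from ONE Kolyvagin certificate** (w3 g5's
`WildSplitEisensteinInclusionAtThreeCertificateRoad.lower_of_certificate`, re-targeted to the registered stub's binders:
free level `N` with `W.conductorNorm ℤ = N`, `Dt : ModularParametrizationData W N`, `H : HeegnerDatum N d_K`).
Hypotheses: Kolyvagin (`hKo`, ∀-fact, a `PublishedInputsWildThree` conjunct); McCallum 1991 Cor. 5.6 in certificate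
(lower) form (`hMcL`, named Literature fact); `W` on `ClassO6 W 3` (so `3 ∣ N`); `K` imaginary quadratic Heegner for
`N` with `d_K` odd; `ι(P) = heegnerPointComplex Dt H`, `P` of infinite order; `3`-adic tower surjectivity
`AdditiveThree.TowerSurjThree W`; and ONE certificate: a square-free `n` of Kolyvagin primes of index `≥ t + s + 1`
(`t = ord₃ ∏_ℓ c_ℓ(E)`, `s = v₃(c(Dt))`) with a Kolyvagin–Heegner datum `d` of conductor `n` on `(Dt, H.β, ι)` whose
derived point `P_n` is not `3^{t+s+1}`-divisible in `E(K[n])`. Conclusion: `SchneiderFree.IndexLowerBoundLeAt W 3 K P s`.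
Proof: `d_K ≠ −3` (the prime `3 ∣ N` splits in `K`), `d_K ≠ −4` (`d_K` odd), tower ⟹ onto mod `3^m` for all `m`, then
`lower_of_certificate`. Every input is an antecedent; nothing asserted about any curve.
[cite: McCallumLMS1991, §5 Cor. 5.6 (p. 310) and Lemma 5.1 (p. 303)] [cite: GrossLMS1991, §4 (4.1)]
[cite: FriedbergHoffstein1995, Thm. B] -/
theorem indexLowerBoundLeAt_FH_of_certificate
    (hKo : ∀ (N : ℕ) [NeZero N] (W : WeierstrassCurve ℚ) (K : Type) [Field K] [NumberField K], kolyvagin N W K)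
    (hMcL : McCallum1991_pow_dvd_card_sha_primary_of_certificate)
    (W : WeierstrassCurve ℚ) [W.IsElliptic] [W.IsGloballyMinimal] (N : ℕ) [NeZero N]
    (K : Type) [Field K] [NumberField K]
    (Dt : ModularParametrizationData W N) (H : HeegnerDatum N (NumberField.discr K)) (ι : K →+* ℂ)
    (P : (W.baseChange K).toAffine.Point)
    (hO6 : Additive.ClassO6 W 3) (hN : W.conductorNorm ℤ = N) (hK : IsImaginaryQuadratic K)
    (hHH : SatisfiesHeegnerHypothesis N K)
    (hP : WeierstrassCurve.Affine.Point.map ι.toRatAlgHom P = heegnerPointComplex Dt H)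
    (hnt : ¬ IsOfFinAddOrder P) (hodd : Odd (NumberField.discr K))
    (htower : AdditiveThree.TowerSurjThree W)
    {n : ℕ} (d : KolyvaginHeegnerData Dt H.β ι n) (hn : Squarefree n)
    (hℓ : ∀ ℓ ∈ n.primeFactors, Zhang2014.IsKolyvaginPrime N W K 3 ℓ ∧
      padicValNat 3 W.tamagawaProduct + padicValNat 3 Dt.c.natAbs + 1 ≤ Zhang2014.kolyvaginIndex W 3 ℓ)
    (hcert : ¬ Koly.PDiv d 3 (padicValNat 3 W.tamagawaProduct + padicValNat 3 Dt.c.natAbs + 1)) :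
    SchneiderFree.IndexLowerBoundLeAt W 3 K P (padicValNat 3 Dt.c.natAbs) := by
  subst hN
  -- `d_K ≠ -4`: `d_K` is odd
  have hd4 : NumberField.discr K ≠ -4 := by
    intro h
    have h2 := Int.odd_iff.mp hodd
    omega
  -- `3 ∣ N(E)` (additive at `3`) splits in `K`; hence `d_K ≠ -3`
  have h3N : 3 ∣ W.conductorNorm ℤ :=
    (W.dvd_conductorNorm_iff_not_hasGoodReductionAtPrime 3).mpr (not_good_of_addv W 3 hO6.2.1)
  have hd3 : NumberField.discr K ≠ -3 := by
    intro h
    exact Literature.SatisfiesHeegnerHypothesis.not_dvd_discr hK.1 hHH Nat.prime_three h3N (by rw [h]; norm_num)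
  haveI : Fact (Nat.Prime 3) := ⟨Nat.prime_three⟩
  exact WildSplitEisensteinInclusionAtThreeCertificateRoad.lower_of_certificate hKo hMcL W 3 (by decide)
    (UniversalToricDescentWaldspurgerFlat.forall_hasSurjectiveModNGaloisRep_pow_three_of_towerSurjThree W htower)
    K hK hd3 hd4 hHH Dt H ι P hP hnt (padicValNat 3 Dt.c.natAbs) d hn hℓ hcert

/-! ### §2 `I_FH` VERBATIM from the certificates on the tower rows and the non-tower rows displayed -/

/-- **The registered research stub `stub_indexLowerBoundFH` (`I_FH`, signature verbatim) from its Kolyvagin side.**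
Hypotheses: Kolyvagin (`hKo`); McCallum Cor. 5.6 lower form (`hMcL`, named); `CERT₃^FH` (`hCert`, displayed): for every
cell curve `W` (`ClassO6 W 3`, `ρ̄₃` onto, `r_an = 1`, `N_E = N`) with `3`-adic TOWER surjectivity and every Heegner datum
`(K, Dt, H, ι, P)` for `N` with `L(E^(d_K),1) ≠ 0`, `ι(P) = heegnerPointComplex Dt H`, `P` of infinite order, `d_K` odd,
and INDEX EXCESS `ord₃[E(K):ℤP] > ord₃∏c_ℓ + v₃(c)`, THERE IS a square-free `n` of Kolyvagin primes of index `≥ ord₃∏c_ℓ + v₃(c) + 1` and a Kolyvagin–Heegner datum `d` of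
conductor `n` on `(Dt, H.β, ι)` with `P_n ∉ 3^{ord₃∏c_ℓ + v₃(c) + 1}E(K[n])` («`M_∞ ≤ ord₃(c·∏c_ℓ)`» in point
currency); and `I_FH|NT` (`hNT`, displayed): the index inequality itself at the same index-excess data of the cell
curves WITHOUT tower surjectivity (onto mod `3`, not mod `9`). Conclusion: `I_FH` as registered on
stmt-BirchSwinnertonDyer-26610. Proof: idle rows by §0; index-excess rows: tower split, §1 on the tower rows. Every input is an antecedent; nothing asserted about any curve.
[cite: McCallumLMS1991, §5 Cor. 5.6 (p. 310)] [cite: WZhang2014, Thm. 1.1 and Remark 18]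
[cite: JetchevSkinnerWan2017, §7.4.1 (arXiv:1512.06894 p. 30)] -/
theorem indexLowerBoundFH_of_certificates
    (hKo : ∀ (N : ℕ) [NeZero N] (W : WeierstrassCurve ℚ) (K : Type) [Field K] [NumberField K], kolyvagin N W K)
    (hMcL : McCallum1991_pow_dvd_card_sha_primary_of_certificate)
    (hCert : ∀ (W : WeierstrassCurve ℚ) [W.IsElliptic] [W.IsGloballyMinimal] (N : ℕ) [NeZero N] (K : Type) [Field K]
      [NumberField K] (Dt : Literature.NumberTheory.EllipticCurves.ModularForms.ModularParametrizationData W N)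
      (H : Literature.NumberTheory.EllipticCurves.HeegnerDatum N (NumberField.discr K)) (ι : K →+* ℂ)
      (P : (W.baseChange K).toAffine.Point),
      Summit.BirchSwinnertonDyer.Rank1Residual.Additive.ClassO6 W 3 → W.HasSurjectiveModNGaloisRep 3 →
      W.analyticRank = 1 → W.conductorNorm ℤ = N → Literature.NumberTheory.EllipticCurves.IsImaginaryQuadratic K →
      Literature.NumberTheory.EllipticCurves.SatisfiesHeegnerHypothesis N K →
      (W.quadraticTwist (NumberField.discr K : ℚ)).entireLFunction 1 ≠ 0 →
      (WeierstrassCurve.Affine.Point.map ι.toRatAlgHom) P =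
        Literature.NumberTheory.EllipticCurves.ModularForms.heegnerPointComplex Dt H →
      ¬ IsOfFinAddOrder P → Odd (NumberField.discr K) →
      Summit.BirchSwinnertonDyer.Rank1Residual.AdditiveThree.TowerSurjThree W →
      padicValNat 3 W.tamagawaProduct + padicValNat 3 Dt.c.natAbs < padicValNat 3 (AddSubgroup.zmultiples P).index →
      ∃ (n : ℕ) (d : Literature.NumberTheory.EllipticCurves.KolyvaginHeegnerData Dt H.β ι n),
        Squarefree n ∧
        (∀ ℓ ∈ n.primeFactors,
          Literature.NumberTheory.EllipticCurves.Zhang2014.IsKolyvaginPrime N W K 3 ℓ ∧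
          padicValNat 3 W.tamagawaProduct + padicValNat 3 Dt.c.natAbs + 1 ≤
            Literature.NumberTheory.EllipticCurves.Zhang2014.kolyvaginIndex W 3 ℓ) ∧
        ¬ Summit.BirchSwinnertonDyer.Rank1Residual.X11b.Three.Koly.PDiv d 3
            (padicValNat 3 W.tamagawaProduct + padicValNat 3 Dt.c.natAbs + 1))
    (hNT : ∀ (W : WeierstrassCurve ℚ) [W.IsElliptic] [W.IsGloballyMinimal] (N : ℕ) [NeZero N] (K : Type) [Field K]
      [NumberField K] (Dt : Literature.NumberTheory.EllipticCurves.ModularForms.ModularParametrizationData W N)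
      (H : Literature.NumberTheory.EllipticCurves.HeegnerDatum N (NumberField.discr K)) (ι : K →+* ℂ)
      (P : (W.baseChange K).toAffine.Point),
      Summit.BirchSwinnertonDyer.Rank1Residual.Additive.ClassO6 W 3 → W.HasSurjectiveModNGaloisRep 3 →
      W.analyticRank = 1 → W.conductorNorm ℤ = N → Literature.NumberTheory.EllipticCurves.IsImaginaryQuadratic K →
      Literature.NumberTheory.EllipticCurves.SatisfiesHeegnerHypothesis N K →
      (W.quadraticTwist (NumberField.discr K : ℚ)).entireLFunction 1 ≠ 0 →
      (WeierstrassCurve.Affine.Point.map ι.toRatAlgHom) P =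
        Literature.NumberTheory.EllipticCurves.ModularForms.heegnerPointComplex Dt H →
      ¬ IsOfFinAddOrder P → Odd (NumberField.discr K) →
      ¬ Summit.BirchSwinnertonDyer.Rank1Residual.AdditiveThree.TowerSurjThree W →
      padicValNat 3 W.tamagawaProduct + padicValNat 3 Dt.c.natAbs < padicValNat 3 (AddSubgroup.zmultiples P).index →
      Summit.BirchSwinnertonDyer.BirchSwinnertonDyer.Theorems.SchneiderFree.IndexLowerBoundLeAt W 3 K P
        (padicValNat 3 Dt.c.natAbs)) :
    ∀ (W : WeierstrassCurve ℚ) [W.IsElliptic] [W.IsGloballyMinimal] (N : ℕ) [NeZero N] (K : Type) [Field K] [NumberField K] (Dt : Literature.NumberTheory.EllipticCurves.ModularForms.ModularParametrizationData W N) (H : Literature.NumberTheory.EllipticCurves.HeegnerDatum N (NumberField.discr K)) (ι : K →+* ℂ) (P : (W.baseChange K).toAffine.Point), Summit.BirchSwinnertonDyer.Rank1Residual.Additive.ClassO6 W 3 → W.HasSurjectiveModNGaloisRep 3 → W.analyticRank = 1 → W.conductorNorm ℤ = N → Literature.NumberTheory.EllipticCurves.IsImaginaryQuadratic K → Literature.NumberTheory.EllipticCurves.SatisfiesHeegnerHypothesis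 N K → (W.quadraticTwist (NumberField.discr K : ℚ)).entireLFunction 1 ≠ 0 → (WeierstrassCurve.Affine.Point.map ι.toRatAlgHom) P = Literature.NumberTheory.EllipticCurves.ModularForms.heegnerPointComplex Dt H → ¬ IsOfFinAddOrder P → Odd (NumberField.discr K) → Summit.BirchSwinnertonDyer.BirchSwinnertonDyer.Theorems.SchneiderFree.IndexLowerBoundLeAt W 3 K P (padicValNat 3 Dt.c.natAbs) := by
  intro W _ _ N _ K _ _ Dt H ι P hO6 hsurj hr hN hK hHH hLt hP hnt hodd
  -- IDLE ROWS: index within the Tamagawa–Manin budget (§0), no input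
  by_cases hex : padicValNat 3 W.tamagawaProduct + padicValNat 3 Dt.c.natAbs <
      padicValNat 3 (AddSubgroup.zmultiples P).index
  swap
  · exact indexLowerBoundLeAt_of_index_le_budget W 3 K P _ (Nat.le_of_not_lt hex)
  -- TOWER SPLIT on the index-excess rows: off the tower-surjective rows the inequality is the displayed residue
  by_cases htower : AdditiveThree.TowerSurjThree W
  swap
  · exact hNT W N K Dt H ι P hO6 hsurj hr hN hK hHH hLt hP hnt hodd htower hex
  -- on the tower rows: ONE certificate, then §1
  obtain ⟨n, d, hn, hℓ, hcert⟩ := hCert W N K Dt H ι P hO6 hsurj hr hN hK hHH hLt hP hnt hodd htower hex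
  exact indexLowerBoundLeAt_FH_of_certificate hKo hMcL W N K Dt H ι P hO6 hN hK hHH hP hnt hodd htower d hn hℓ
    hcert

/-! ### §3 The crux of record BY NAME from print, Poitou–Tate, McCallum (lower) and the certificates -/

/-- **`WildSplitEisensteinValueAtOneV` (stmt-BirchSwinnertonDyer-26610) BY NAME from its Kolyvagin side**:
`PublishedInputsWildThree → McCallum Cor. 5.6 (lower, named) → CERT₃^FH → I_FH|NT → PoitouTateSelmerStructureDualityFact
(PT1) → PT2 → E_𝟙^V` — §2 (Kolyvagin is a PUB conjunct) composed with p614377 §2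
(`WildSplitEisensteinValueAtOneVIndexCurrency.valueAtOneV_of_indexLowerBoundFH_of_poitouTate`: `I_FH` + the control
equality at `𝔭′` from PT1 ∧ PT2 + the value display). The line `index` with its research stub replaced by {one print
fact, one per-pair-decidable certificate statement on the tower rows, the non-tower residue}. Every crux, fact and
certificate statement is an antecedent; nothing asserted about any curve; BSD₃ is proved for no curve.
[cite: McCallumLMS1991, §5 Cor. 5.6 (p. 310)] [cite: JetchevSkinnerWan2017, Thm. 3.3.1 and §7.4.1 (arXiv:1512.06894 pp. 11, 30)]
[cite: MilneADT2006, Ch. I, Thm. 4.10(b)] -/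
theorem valueAtOneV_of_certificates_of_poitouTate (hF : PublishedInputsWildThree)
    (hMcL : McCallum1991_pow_dvd_card_sha_primary_of_certificate)
    (hCert : ∀ (W : WeierstrassCurve ℚ) [W.IsElliptic] [W.IsGloballyMinimal] (N : ℕ) [NeZero N] (K : Type) [Field K]
      [NumberField K] (Dt : Literature.NumberTheory.EllipticCurves.ModularForms.ModularParametrizationData W N)
      (H : Literature.NumberTheory.EllipticCurves.HeegnerDatum N (NumberField.discr K)) (ι : K →+* ℂ)
      (P : (W.baseChange K).toAffine.Point),
      Summit.BirchSwinnertonDyer.Rank1Residual.Additive.ClassO6 W 3 → W.HasSurjectiveModNGaloisRep 3 →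
      W.analyticRank = 1 → W.conductorNorm ℤ = N → Literature.NumberTheory.EllipticCurves.IsImaginaryQuadratic K →
      Literature.NumberTheory.EllipticCurves.SatisfiesHeegnerHypothesis N K →
      (W.quadraticTwist (NumberField.discr K : ℚ)).entireLFunction 1 ≠ 0 →
      (WeierstrassCurve.Affine.Point.map ι.toRatAlgHom) P =
        Literature.NumberTheory.EllipticCurves.ModularForms.heegnerPointComplex Dt H →
      ¬ IsOfFinAddOrder P → Odd (NumberField.discr K) →
      Summit.BirchSwinnertonDyer.Rank1Residual.AdditiveThree.TowerSurjThree W →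
      padicValNat 3 W.tamagawaProduct + padicValNat 3 Dt.c.natAbs < padicValNat 3 (AddSubgroup.zmultiples P).index →
      ∃ (n : ℕ) (d : Literature.NumberTheory.EllipticCurves.KolyvaginHeegnerData Dt H.β ι n),
        Squarefree n ∧
        (∀ ℓ ∈ n.primeFactors,
          Literature.NumberTheory.EllipticCurves.Zhang2014.IsKolyvaginPrime N W K 3 ℓ ∧
          padicValNat 3 W.tamagawaProduct + padicValNat 3 Dt.c.natAbs + 1 ≤
            Literature.NumberTheory.EllipticCurves.Zhang2014.kolyvaginIndex W 3 ℓ) ∧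
        ¬ Summit.BirchSwinnertonDyer.Rank1Residual.X11b.Three.Koly.PDiv d 3
            (padicValNat 3 W.tamagawaProduct + padicValNat 3 Dt.c.natAbs + 1))
    (hNT : ∀ (W : WeierstrassCurve ℚ) [W.IsElliptic] [W.IsGloballyMinimal] (N : ℕ) [NeZero N] (K : Type) [Field K]
      [NumberField K] (Dt : Literature.NumberTheory.EllipticCurves.ModularForms.ModularParametrizationData W N)
      (H : Literature.NumberTheory.EllipticCurves.HeegnerDatum N (NumberField.discr K)) (ι : K →+* ℂ)
      (P : (W.baseChange K).toAffine.Point),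
      Summit.BirchSwinnertonDyer.Rank1Residual.Additive.ClassO6 W 3 → W.HasSurjectiveModNGaloisRep 3 →
      W.analyticRank = 1 → W.conductorNorm ℤ = N → Literature.NumberTheory.EllipticCurves.IsImaginaryQuadratic K →
      Literature.NumberTheory.EllipticCurves.SatisfiesHeegnerHypothesis N K →
      (W.quadraticTwist (NumberField.discr K : ℚ)).entireLFunction 1 ≠ 0 →
      (WeierstrassCurve.Affine.Point.map ι.toRatAlgHom) P =
        Literature.NumberTheory.EllipticCurves.ModularForms.heegnerPointComplex Dt H →
      ¬ IsOfFinAddOrder P → Odd (NumberField.discr K) →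
      ¬ Summit.BirchSwinnertonDyer.Rank1Residual.AdditiveThree.TowerSurjThree W →
      padicValNat 3 W.tamagawaProduct + padicValNat 3 Dt.c.natAbs < padicValNat 3 (AddSubgroup.zmultiples P).index →
      Summit.BirchSwinnertonDyer.BirchSwinnertonDyer.Theorems.SchneiderFree.IndexLowerBoundLeAt W 3 K P
        (padicValNat 3 Dt.c.natAbs))
    (hPT : PoitouTateSelmerStructureDualityFact)
    (hPT2 : ∀ (K : Type) [Field K] [NumberField K], Literature.NumberTheory.GaloisCohomology.poitouTate_sha_tateDual K) :
    WildSplitEisensteinValueAtOneV :=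
  WildSplitEisensteinValueAtOneVIndexCurrency.valueAtOneV_of_indexLowerBoundFH_of_poitouTate hF
    (indexLowerBoundFH_of_certificates hF.2.1 hMcL hCert hNT) hPT hPT2

/-- **The same with the line's `stub_poitouTateConj`** (item 23092 `PoitouTateSelmerDualityConjInput`, the conj-compatible
Poitou–Tate input of the route's `closes`) in place of PT1: PT1 follows by
`poitouTate_selmerStructure_duality_of_conj`. So, stub for stub, line `index` =
{`stub_publishedInputs`, `stub_poitouTateConj`, `stub_poitouTateSha`} + [`stub_indexLowerBoundFH` ⟸ McCallum (lower,
print) ∧ `CERT₃^FH` ∧ `I_FH|NT`]. Every input is an antecedent; nothing asserted about any curve.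
[cite: MilneADT2006, Ch. I, Thm. 4.10] [cite: McCallumLMS1991, §5 Cor. 5.6 (p. 310)] -/
theorem valueAtOneV_of_certificates_of_poitouTateConj (hF : PublishedInputsWildThree)
    (hMcL : McCallum1991_pow_dvd_card_sha_primary_of_certificate)
    (hCert : ∀ (W : WeierstrassCurve ℚ) [W.IsElliptic] [W.IsGloballyMinimal] (N : ℕ) [NeZero N] (K : Type) [Field K]
      [NumberField K] (Dt : Literature.NumberTheory.EllipticCurves.ModularForms.ModularParametrizationData W N)
      (H : Literature.NumberTheory.EllipticCurves.HeegnerDatum N (NumberField.discr K)) (ι : K →+* ℂ)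
      (P : (W.baseChange K).toAffine.Point),
      Summit.BirchSwinnertonDyer.Rank1Residual.Additive.ClassO6 W 3 → W.HasSurjectiveModNGaloisRep 3 →
      W.analyticRank = 1 → W.conductorNorm ℤ = N → Literature.NumberTheory.EllipticCurves.IsImaginaryQuadratic K →
      Literature.NumberTheory.EllipticCurves.SatisfiesHeegnerHypothesis N K →
      (W.quadraticTwist (NumberField.discr K : ℚ)).entireLFunction 1 ≠ 0 →
      (WeierstrassCurve.Affine.Point.map ι.toRatAlgHom) P =
        Literature.NumberTheory.EllipticCurves.ModularForms.heegnerPointComplex Dt H →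
      ¬ IsOfFinAddOrder P → Odd (NumberField.discr K) →
      Summit.BirchSwinnertonDyer.Rank1Residual.AdditiveThree.TowerSurjThree W →
      padicValNat 3 W.tamagawaProduct + padicValNat 3 Dt.c.natAbs < padicValNat 3 (AddSubgroup.zmultiples P).index →
      ∃ (n : ℕ) (d : Literature.NumberTheory.EllipticCurves.KolyvaginHeegnerData Dt H.β ι n),
        Squarefree n ∧
        (∀ ℓ ∈ n.primeFactors,
          Literature.NumberTheory.EllipticCurves.Zhang2014.IsKolyvaginPrime N W K 3 ℓ ∧
          padicValNat 3 W.tamagawaProduct + padicValNat 3 Dt.c.natAbs + 1 ≤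
            Literature.NumberTheory.EllipticCurves.Zhang2014.kolyvaginIndex W 3 ℓ) ∧
        ¬ Summit.BirchSwinnertonDyer.Rank1Residual.X11b.Three.Koly.PDiv d 3
            (padicValNat 3 W.tamagawaProduct + padicValNat 3 Dt.c.natAbs + 1))
    (hNT : ∀ (W : WeierstrassCurve ℚ) [W.IsElliptic] [W.IsGloballyMinimal] (N : ℕ) [NeZero N] (K : Type) [Field K]
      [NumberField K] (Dt : Literature.NumberTheory.EllipticCurves.ModularForms.ModularParametrizationData W N)
      (H : Literature.NumberTheory.EllipticCurves.HeegnerDatum N (NumberField.discr K)) (ι : K →+* ℂ)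
      (P : (W.baseChange K).toAffine.Point),
      Summit.BirchSwinnertonDyer.Rank1Residual.Additive.ClassO6 W 3 → W.HasSurjectiveModNGaloisRep 3 →
      W.analyticRank = 1 → W.conductorNorm ℤ = N → Literature.NumberTheory.EllipticCurves.IsImaginaryQuadratic K →
      Literature.NumberTheory.EllipticCurves.SatisfiesHeegnerHypothesis N K →
      (W.quadraticTwist (NumberField.discr K : ℚ)).entireLFunction 1 ≠ 0 →
      (WeierstrassCurve.Affine.Point.map ι.toRatAlgHom) P =
        Literature.NumberTheory.EllipticCurves.ModularForms.heegnerPointComplex Dt H →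
      ¬ IsOfFinAddOrder P → Odd (NumberField.discr K) →
      ¬ Summit.BirchSwinnertonDyer.Rank1Residual.AdditiveThree.TowerSurjThree W →
      padicValNat 3 W.tamagawaProduct + padicValNat 3 Dt.c.natAbs < padicValNat 3 (AddSubgroup.zmultiples P).index →
      Summit.BirchSwinnertonDyer.BirchSwinnertonDyer.Theorems.SchneiderFree.IndexLowerBoundLeAt W 3 K P
        (padicValNat 3 Dt.c.natAbs))
    (hPTc : PoitouTateSelmerDualityConjInput)
    (hPT2 : ∀ (K : Type) [Field K] [NumberField K], Literature.NumberTheory.GaloisCohomology.poitouTate_sha_tateDual K) :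
    WildSplitEisensteinValueAtOneV :=
  valueAtOneV_of_certificates_of_poitouTate hF hMcL hCert hNT
    (fun K _ _ ↦ Literature.NumberTheory.GaloisCohomology.poitouTate_selmerStructure_duality_of_conj (hPTc K)) hPT2

end Summit.BirchSwinnertonDyer.BirchSwinnertonDyer.Theorems.WildSplitEisensteinValueAtOneVCertificateRoad

end
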